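import Literature.Computability.AlgebraicComplexity.BorderApolarityBorelTriples
import Literature.Computability.AlgebraicComplexity.MatrixMultiplicationExponent
import HarnessLib

/-!
# Borel data for `⟨3,3,3⟩`: weights, root moves, invariance — the Borel-fixed candidate triple

Topic `Literature/Computability/AlgebraicComplexity`. First `⟨3,3,3⟩`-specific file of the
proof of Conner–Harper–Landsberg 2023, Thm. 1.1 (`R̲(M⟨3⟩) ≥ 17`) over the tree's algebraic border
rank, on top of `BorderApolarity.exists_borelFixed_candidateTriple`. In the coordinates
`t = matMulTensor K 3 3 3 = ∑_{ijk} a_{ik} ⊗ b_{ij} ⊗ c_{jk}` (`a = (i,k)`, `b = (i,j)`, `c = (j,k)`)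
the group `GL(U) × GL(V) × GL(W)` acts on `i` (vector on `a`, dual on `b`), `j` (vector on `b`,
dual on `c`), `k` (vector on `a`, dual on `c`). This file fixes:

* `MatMul3.eA, eB, eC` — integer weights of a one-parameter torus (`φ = (0,1,3)` on `i`,
  `θ = (0,7,21)` on `j`, `ψ = (0,49,147)` on `k`) under which the slices of `t` are weight vectors
  and distinct torus characters of the three pair spaces get distinct weights;
* `MatMul3.PZ, QZ, RZ : Fin 3 → Fin 3 → Matrix (Fin 3 × Fin 3) (Fin 3 × Fin 3) ℤ` — the nine root
  moves `(P, Q, R)` (group `g ∈ {U, V, W}`, positive root `ρ ∈ {(0,1), (0,2), (1,2)}`), unipotent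
  `1 ± X_{pq}` on the relevant slots, with their inverses `PZ'`, `QZ'`, `RZ'`;
* PROVED: `t`-invariance (`MatMul3.invariant`), left inverses, lowering unitriangularity for the
  weights, homogeneity of the slices, and a choice of `16` coordinate triples with pairwise-injective
  projections; whence `MatMul3.exists_borelFixed_triple` — **an order-`h` approximate decomposition
  of `⟨3,3,3⟩` with `16` triads yields a graded candidate triple fixed by the nine root moves.**

## References

* A. Conner, A. Harper, J. M. Landsberg, *New lower bounds for matrix multiplication and `det₃`*,
  Forum Math. Pi 11 (2023) e17, arXiv:1911.07981 — §2.4–§2.5, §6 (`M⟨3⟩`). [ConnerHarperLandsberg2023]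
-/

noncomputable section

open Polynomial Matrix
open scoped Polynomial BigOperators Kronecker

namespace Literature.Computability.AlgebraicComplexity

namespace BorderApolarity

namespace MatMul3

open TensorApolarity

universe u

/-- The index type `Fin 3 × Fin 3` of each slot of `⟨3,3,3⟩`. [folklore] -/
abbrev I9 : Type := Fin 3 × Fin 3

/-! ## Weights -/

/-- Torus weights on the index `i` (group `U`). [cite: ConnerHarperLandsberg2023, §2.5] -/
def φw : Fin 3 → ℕ := ![0, 1, 3]

/-- Torus weights on the index `j` (group `V`). [cite: ConnerHarperLandsberg2023, §2.5] -/
def θw : Fin 3 → ℕ := ![0, 7, 21]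

/-- Torus weights on the index `k` (group `W`). [cite: ConnerHarperLandsberg2023, §2.5] -/
def ψw : Fin 3 → ℕ := ![0, 49, 147]

/-- Weight of the output coordinate `a = (i, k)` (`U ⊗ W`). [cite: ConnerHarperLandsberg2023, §2.5] -/
def eA : I9 → ℕ := fun a => φw a.1 + ψw a.2

/-- Weight of the coordinate `b = (i, j)` (`U^* ⊗ V`). [cite: ConnerHarperLandsberg2023, §2.5] -/
def eB : I9 → ℕ := fun b => (3 - φw b.1) + θw b.2

/-- Weight of the coordinate `c = (j, k)` (`V^* ⊗ W^*`). [cite: ConnerHarperLandsberg2023, §2.5] -/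
def eC : I9 → ℕ := fun c => (21 - θw c.1) + (147 - ψw c.2)

/-- All weights are `< 169`. [folklore] -/
theorem eA_lt (a : I9) : eA a < 169 := by revert a; decide

/-- All weights are `< 169`. [folklore] -/
theorem eB_lt (b : I9) : eB b < 169 := by revert b; decide

/-- All weights are `< 169`. [folklore] -/
theorem eC_lt (c : I9) : eC c < 169 := by revert c; decide

/-! ## The nine root moves over `ℤ` -/

/-- The positive roots `(p, q)`, `p < q`, of `GL₃`, indexed by `Fin 3`. [folklore] -/
def rootPQ : Fin 3 → Fin 3 × Fin 3 := ![(0, 1), (0, 2), (1, 2)]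

/-- `P`-factor (slot `a = (i,k)`) of the root move `(g, ρ)`: group `U` (`g = 0`) acts on `i` as
`1 + X_{pq}`, group `W` (`g = 2`) on `k` as `1 + X_{pq}`, group `V` trivially.
[cite: ConnerHarperLandsberg2023, §2.5] -/
def PZ (g ρ : Fin 3) : Matrix I9 I9 ℤ := fun a a' =>
  (if a = a' then 1 else 0) +
    (if g = 0 ∧ a.1 = (rootPQ ρ).1 ∧ a'.1 = (rootPQ ρ).2 ∧ a.2 = a'.2 then 1 else 0) +
    (if g = 2 ∧ a.2 = (rootPQ ρ).1 ∧ a'.2 = (rootPQ ρ).2 ∧ a.1 = a'.1 then 1 else 0)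

/-- `Q`-factor (slot `b = (i,j)`): `U` acts dually on `i` (`1 - X_{qp}`), `V` on `j` (`1 + X_{pq}`).
[cite: ConnerHarperLandsberg2023, §2.5] -/
def QZ (g ρ : Fin 3) : Matrix I9 I9 ℤ := fun b b' =>
  (if b = b' then 1 else 0) -
    (if g = 0 ∧ b.1 = (rootPQ ρ).2 ∧ b'.1 = (rootPQ ρ).1 ∧ b.2 = b'.2 then 1 else 0) +
    (if g = 1 ∧ b.2 = (rootPQ ρ).1 ∧ b'.2 = (rootPQ ρ).2 ∧ b.1 = b'.1 then 1 else 0)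

/-- `R`-factor (slot `c = (j,k)`): `V` acts dually on `j`, `W` dually on `k`.
[cite: ConnerHarperLandsberg2023, §2.5] -/
def RZ (g ρ : Fin 3) : Matrix I9 I9 ℤ := fun c c' =>
  (if c = c' then 1 else 0) -
    (if g = 1 ∧ c.1 = (rootPQ ρ).2 ∧ c'.1 = (rootPQ ρ).1 ∧ c.2 = c'.2 then 1 else 0) -
    (if g = 2 ∧ c.2 = (rootPQ ρ).2 ∧ c'.2 = (rootPQ ρ).1 ∧ c.1 = c'.1 then 1 else 0)

/-- Inverse of `PZ` (opposite sign of the nilpotent part). [folklore] -/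
def PZ' (g ρ : Fin 3) : Matrix I9 I9 ℤ := fun a a' =>
  (if a = a' then 1 else 0) -
    (if g = 0 ∧ a.1 = (rootPQ ρ).1 ∧ a'.1 = (rootPQ ρ).2 ∧ a.2 = a'.2 then 1 else 0) -
    (if g = 2 ∧ a.2 = (rootPQ ρ).1 ∧ a'.2 = (rootPQ ρ).2 ∧ a.1 = a'.1 then 1 else 0)

/-- Inverse of `QZ`. [folklore] -/
def QZ' (g ρ : Fin 3) : Matrix I9 I9 ℤ := fun b b' =>
  (if b = b' then 1 else 0) +
    (if g = 0 ∧ b.1 = (rootPQ ρ).2 ∧ b'.1 = (rootPQ ρ).1 ∧ b.2 = b'.2 then 1 else 0) -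
    (if g = 1 ∧ b.2 = (rootPQ ρ).1 ∧ b'.2 = (rootPQ ρ).2 ∧ b.1 = b'.1 then 1 else 0)

/-- Inverse of `RZ`. [folklore] -/
def RZ' (g ρ : Fin 3) : Matrix I9 I9 ℤ := fun c c' =>
  (if c = c' then 1 else 0) +
    (if g = 1 ∧ c.1 = (rootPQ ρ).2 ∧ c'.1 = (rootPQ ρ).1 ∧ c.2 = c'.2 then 1 else 0) +
    (if g = 2 ∧ c.2 = (rootPQ ρ).2 ∧ c'.2 = (rootPQ ρ).1 ∧ c.1 = c'.1 then 1 else 0)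

/-- `PZ' · PZ = 1`. [folklore] -/
theorem PZ'_mul_PZ (g ρ : Fin 3) : PZ' g ρ * PZ g ρ = 1 := by
  revert g ρ; decide

/-- `QZ' · QZ = 1`. [folklore] -/
theorem QZ'_mul_QZ (g ρ : Fin 3) : QZ' g ρ * QZ g ρ = 1 := by
  revert g ρ; decide

/-- `RZ' · RZ = 1`. [folklore] -/
theorem RZ'_mul_RZ (g ρ : Fin 3) : RZ' g ρ * RZ g ρ = 1 := by
  revert g ρ; decide

/-- `RZ = 1` for the `U`-roots, `PZ = 1` for the `V`-roots, `QZ = 1` for the `W`-roots. [folklore] -/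
theorem RZ_zero (ρ : Fin 3) : RZ 0 ρ = 1 := by revert ρ; decide

/-- `PZ = 1` for the `V`-roots. [folklore] -/
theorem PZ_one (ρ : Fin 3) : PZ 1 ρ = 1 := by revert ρ; decide

/-- `QZ = 1` for the `W`-roots. [folklore] -/
theorem QZ_two (ρ : Fin 3) : QZ 2 ρ = 1 := by revert ρ; decide

/-- Invariance of `⟨3,3,3⟩` under the `U`-move `ρ = 0`. [cite: ConnerHarperLandsberg2023, §2.4] -/
theorem invariantZ_U0 : ∀ (a b c : I9),
    ∑ a', ∑ b', PZ 0 0 a a' * QZ 0 0 b b' * matMulTensor ℤ 3 3 3 a' b' c = matMulTensor ℤ 3 3 3 a b c := by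
  decide +kernel

/-- Invariance of `⟨3,3,3⟩` under the `U`-move `ρ = 1`. [cite: ConnerHarperLandsberg2023, §2.4] -/
theorem invariantZ_U1 : ∀ (a b c : I9),
    ∑ a', ∑ b', PZ 0 1 a a' * QZ 0 1 b b' * matMulTensor ℤ 3 3 3 a' b' c = matMulTensor ℤ 3 3 3 a b c := by
  decide +kernel

/-- Invariance of `⟨3,3,3⟩` under the `U`-move `ρ = 2`. [cite: ConnerHarperLandsberg2023, §2.4] -/
theorem invariantZ_U2 : ∀ (a b c : I9),
    ∑ a', ∑ b', PZ 0 2 a a' * QZ 0 2 b b' * matMulTensor ℤ 3 3 3 a' b' c = matMulTensor ℤ 3 3 3 a b c := by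
  decide +kernel

/-- Invariance of `⟨3,3,3⟩` under the `U`-root moves. [cite: ConnerHarperLandsberg2023, §2.4] -/
theorem invariantZ_U : ∀ (ρ : Fin 3) (a b c : I9),
    ∑ a', ∑ b', PZ 0 ρ a a' * QZ 0 ρ b b' * matMulTensor ℤ 3 3 3 a' b' c =
      matMulTensor ℤ 3 3 3 a b c := by
  intro ρ; fin_cases ρ; exacts [invariantZ_U0, invariantZ_U1, invariantZ_U2]

/-- Invariance of `⟨3,3,3⟩` under the `V`-move `ρ = 0`. [cite: ConnerHarperLandsberg2023, §2.4] -/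
theorem invariantZ_V0 : ∀ (a b c : I9),
    ∑ b', ∑ c', QZ 1 0 b b' * RZ 1 0 c c' * matMulTensor ℤ 3 3 3 a b' c' = matMulTensor ℤ 3 3 3 a b c := by
  decide +kernel

/-- Invariance of `⟨3,3,3⟩` under the `V`-move `ρ = 1`. [cite: ConnerHarperLandsberg2023, §2.4] -/
theorem invariantZ_V1 : ∀ (a b c : I9),
    ∑ b', ∑ c', QZ 1 1 b b' * RZ 1 1 c c' * matMulTensor ℤ 3 3 3 a b' c' = matMulTensor ℤ 3 3 3 a b c := by
  decide +kernel

/-- Invariance of `⟨3,3,3⟩` under the `V`-move `ρ = 2`. [cite: ConnerHarperLandsberg2023, §2.4] -/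
theorem invariantZ_V2 : ∀ (a b c : I9),
    ∑ b', ∑ c', QZ 1 2 b b' * RZ 1 2 c c' * matMulTensor ℤ 3 3 3 a b' c' = matMulTensor ℤ 3 3 3 a b c := by
  decide +kernel

/-- Invariance of `⟨3,3,3⟩` under the `V`-root moves. [cite: ConnerHarperLandsberg2023, §2.4] -/
theorem invariantZ_V : ∀ (ρ : Fin 3) (a b c : I9),
    ∑ b', ∑ c', QZ 1 ρ b b' * RZ 1 ρ c c' * matMulTensor ℤ 3 3 3 a b' c' =
      matMulTensor ℤ 3 3 3 a b c := by
  intro ρ; fin_cases ρ; exacts [invariantZ_V0, invariantZ_V1, invariantZ_V2]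

/-- Invariance of `⟨3,3,3⟩` under the `W`-move `ρ = 0`. [cite: ConnerHarperLandsberg2023, §2.4] -/
theorem invariantZ_W0 : ∀ (a b c : I9),
    ∑ a', ∑ c', PZ 2 0 a a' * RZ 2 0 c c' * matMulTensor ℤ 3 3 3 a' b c' = matMulTensor ℤ 3 3 3 a b c := by
  decide +kernel

/-- Invariance of `⟨3,3,3⟩` under the `W`-move `ρ = 1`. [cite: ConnerHarperLandsberg2023, §2.4] -/
theorem invariantZ_W1 : ∀ (a b c : I9),
    ∑ a', ∑ c', PZ 2 1 a a' * RZ 2 1 c c' * matMulTensor ℤ 3 3 3 a' b c' = matMulTensor ℤ 3 3 3 a b c := by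
  decide +kernel

/-- Invariance of `⟨3,3,3⟩` under the `W`-move `ρ = 2`. [cite: ConnerHarperLandsberg2023, §2.4] -/
theorem invariantZ_W2 : ∀ (a b c : I9),
    ∑ a', ∑ c', PZ 2 2 a a' * RZ 2 2 c c' * matMulTensor ℤ 3 3 3 a' b c' = matMulTensor ℤ 3 3 3 a b c := by
  decide +kernel

/-- Invariance of `⟨3,3,3⟩` under the `W`-root moves. [cite: ConnerHarperLandsberg2023, §2.4] -/
theorem invariantZ_W : ∀ (ρ : Fin 3) (a b c : I9),
    ∑ a', ∑ c', PZ 2 ρ a a' * RZ 2 ρ c c' * matMulTensor ℤ 3 3 3 a' b c' =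
      matMulTensor ℤ 3 3 3 a b c := by
  intro ρ; fin_cases ρ; exacts [invariantZ_W0, invariantZ_W1, invariantZ_W2]

/-- `∑_{y} 1_{xy} f(y) = f(x)`. [folklore] -/
theorem sum_one_apply_mul (x : I9) (f : I9 → ℤ) : ∑ y, (1 : Matrix I9 I9 ℤ) x y * f y = f x := by
  simp only [Matrix.one_apply, ite_mul, one_mul, zero_mul, Finset.sum_ite_eq, Finset.mem_univ,
    if_true]

/-- **`⟨3,3,3⟩` is invariant under the nine root moves** (over `ℤ`).
[cite: ConnerHarperLandsberg2023, §2.4] -/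
theorem invariantZ (g ρ : Fin 3) (a b c : I9) :
    ∑ a', ∑ b', ∑ c', PZ g ρ a a' * QZ g ρ b b' * RZ g ρ c c' * matMulTensor ℤ 3 3 3 a' b' c' =
      matMulTensor ℤ 3 3 3 a b c := by
  fin_cases g
  · -- `U`: `R = 1`, collapse the innermost sum
    simp only [Fin.zero_eta, RZ_zero]
    rw [← invariantZ_U ρ a b c]
    refine Finset.sum_congr rfl fun a' _ => Finset.sum_congr rfl fun b' _ => ?_
    rw [← sum_one_apply_mul c (fun c' => matMulTensor ℤ 3 3 3 a' b' c'), Finset.mul_sum]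
    exact Finset.sum_congr rfl fun c' _ => by ring
  · -- `V`: `P = 1`, collapse the outermost sum
    simp only [Fin.mk_one, PZ_one]
    rw [← invariantZ_V ρ a b c, ← sum_one_apply_mul a (fun a' => ∑ b', ∑ c',
      QZ 1 ρ b b' * RZ 1 ρ c c' * matMulTensor ℤ 3 3 3 a' b' c')]
    refine Finset.sum_congr rfl fun a' _ => ?_
    rw [Finset.mul_sum]
    refine Finset.sum_congr rfl fun b' _ => ?_
    rw [Finset.mul_sum]
    exact Finset.sum_congr rfl fun c' _ => by ring
  · -- `W`: `Q = 1`, collapse the middle sum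
    simp only [Fin.reduceFinMk, QZ_two]
    rw [← invariantZ_W ρ a b c]
    refine Finset.sum_congr rfl fun a' _ => ?_
    rw [← sum_one_apply_mul b (fun b' => ∑ c',
      PZ 2 ρ a a' * RZ 2 ρ c c' * matMulTensor ℤ 3 3 3 a' b' c')]
    refine Finset.sum_congr rfl fun b' _ => ?_
    rw [Finset.mul_sum]
    exact Finset.sum_congr rfl fun c' _ => by ring

/-- Diagonal entries of the moves are `1`, off-diagonal entries lower the weights (integer facts,
kernel-checked). [folklore] -/
theorem PZ_diag : ∀ (g ρ : Fin 3) (a : I9), PZ g ρ a a = 1 := by decide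

/-- Off-diagonal entries of `PZ` lower the weight `eA`. [folklore] -/
theorem PZ_lower : ∀ (g ρ : Fin 3) (a a' : I9), a ≠ a' → PZ g ρ a a' ≠ 0 → eA a < eA a' := by decide

/-- Diagonal entries of `QZ` are `1`. [folklore] -/
theorem QZ_diag : ∀ (g ρ : Fin 3) (b : I9), QZ g ρ b b = 1 := by decide

/-- Off-diagonal entries of `QZ` lower the weight `eB`. [folklore] -/
theorem QZ_lower : ∀ (g ρ : Fin 3) (b b' : I9), b ≠ b' → QZ g ρ b b' ≠ 0 → eB b < eB b' := by decide

/-- Diagonal entries of `RZ` are `1`. [folklore] -/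
theorem RZ_diag : ∀ (g ρ : Fin 3) (c : I9), RZ g ρ c c = 1 := by decide

/-- Off-diagonal entries of `RZ` lower the weight `eC`. [folklore] -/
theorem RZ_lower : ∀ (g ρ : Fin 3) (c c' : I9), c ≠ c' → RZ g ρ c c' ≠ 0 → eC c < eC c' := by decide

/-- The slices of `⟨3,3,3⟩` are weight vectors: `(110)` weights depend on `c` only.
[cite: ConnerHarperLandsberg2023, §2.5] -/
theorem weight_slice₁ : ∀ (c a b : I9), matMulTensor ℤ 3 3 3 a b c ≠ 0 →
    eA a + eB b = 3 + θw c.1 + ψw c.2 := by decide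

/-- `(011)` weights depend on `a` only. [cite: ConnerHarperLandsberg2023, §2.5] -/
theorem weight_slice₂ : ∀ (a b c : I9), matMulTensor ℤ 3 3 3 a b c ≠ 0 →
    eB b + eC c = 171 - φw a.1 - ψw a.2 := by decide

/-- `(101)` weights depend on `b` only. [cite: ConnerHarperLandsberg2023, §2.5] -/
theorem weight_slice₃ : ∀ (b a c : I9), matMulTensor ℤ 3 3 3 a b c ≠ 0 →
    eA a + eC c = 168 + φw b.1 - θw b.2 := by decide

/-! ## Sixteen coordinate triples with pairwise-injective projections -/

/-- Reduction modulo `3`. [folklore] -/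
def f3 (n : ℕ) : Fin 3 := ⟨n % 3, Nat.mod_lt _ (by decide)⟩

/-- Sixteen coordinate triples `(pa, pb, pc)` whose three pair projections are injective
(`ρ ↦ ((ρ, ρ/3), (ρ, ρ/9), (ρ/3, ρ/9 + ρ))` modulo `3`). [folklore] -/
def tri (ρ : Fin 16) : I9 × I9 × I9 :=
  ((f3 ρ, f3 (ρ / 3)), (f3 ρ, f3 (ρ / 9)), (f3 (ρ / 3), f3 (ρ / 9 + ρ)))

/-- The `(a, b)` projection is injective. [folklore] -/
theorem tri_injective₁₂ : Function.Injective fun ρ => ((tri ρ).1, (tri ρ).2.1) := by decide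

/-- The `(b, c)` projection is injective. [folklore] -/
theorem tri_injective₂₃ : Function.Injective fun ρ => ((tri ρ).2.1, (tri ρ).2.2) := by decide

/-- The `(a, c)` projection is injective. [folklore] -/
theorem tri_injective₁₃ : Function.Injective fun ρ => ((tri ρ).1, (tri ρ).2.2) := by decide

/-! ## The moves over a field and the Borel-fixed candidate triple of `⟨3,3,3⟩` -/

section Field

variable (K : Type u) [Field K]

/-- The `P`-factor of the root move `(g, ρ)` over `K`. [cite: ConnerHarperLandsberg2023, §2.5] -/
def Pm (gρ : Fin 3 × Fin 3) : Matrix I9 I9 K := (PZ gρ.1 gρ.2).map (Int.castRingHom K)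

/-- The `Q`-factor of the root move `(g, ρ)` over `K`. [cite: ConnerHarperLandsberg2023, §2.5] -/
def Qm (gρ : Fin 3 × Fin 3) : Matrix I9 I9 K := (QZ gρ.1 gρ.2).map (Int.castRingHom K)

/-- The `R`-factor of the root move `(g, ρ)` over `K`. [cite: ConnerHarperLandsberg2023, §2.5] -/
def Rm (gρ : Fin 3 × Fin 3) : Matrix I9 I9 K := (RZ gρ.1 gρ.2).map (Int.castRingHom K)

/-- Left inverse of `Pm`. [folklore] -/
def Pm' (gρ : Fin 3 × Fin 3) : Matrix I9 I9 K := (PZ' gρ.1 gρ.2).map (Int.castRingHom K)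

/-- Left inverse of `Qm`. [folklore] -/
def Qm' (gρ : Fin 3 × Fin 3) : Matrix I9 I9 K := (QZ' gρ.1 gρ.2).map (Int.castRingHom K)

/-- Left inverse of `Rm`. [folklore] -/
def Rm' (gρ : Fin 3 × Fin 3) : Matrix I9 I9 K := (RZ' gρ.1 gρ.2).map (Int.castRingHom K)

/-- `Pm' · Pm = 1`. [folklore] -/
theorem Pm'_mul_Pm (gρ : Fin 3 × Fin 3) : Pm' K gρ * Pm K gρ = 1 := by
  rw [Pm', Pm, ← Matrix.map_mul, PZ'_mul_PZ, Matrix.map_one _ (map_zero _) (map_one _)]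

/-- `Qm' · Qm = 1`. [folklore] -/
theorem Qm'_mul_Qm (gρ : Fin 3 × Fin 3) : Qm' K gρ * Qm K gρ = 1 := by
  rw [Qm', Qm, ← Matrix.map_mul, QZ'_mul_QZ, Matrix.map_one _ (map_zero _) (map_one _)]

/-- `Rm' · Rm = 1`. [folklore] -/
theorem Rm'_mul_Rm (gρ : Fin 3 × Fin 3) : Rm' K gρ * Rm K gρ = 1 := by
  rw [Rm', Rm, ← Matrix.map_mul, RZ'_mul_RZ, Matrix.map_one _ (map_zero _) (map_one _)]

/-- `Pm` is unitriangular lowering `eA`. [cite: ConnerHarperLandsberg2023, §2.5] -/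
theorem isLoweringUnitriangular_Pm (gρ : Fin 3 × Fin 3) : IsLoweringUnitriangular eA (Pm K gρ) :=
  ⟨fun a => by simp [Pm, PZ_diag], fun a a' hne h =>
    PZ_lower gρ.1 gρ.2 a a' hne fun h0 => h (by simp [Pm, h0])⟩

/-- `Qm` is unitriangular lowering `eB`. [cite: ConnerHarperLandsberg2023, §2.5] -/
theorem isLoweringUnitriangular_Qm (gρ : Fin 3 × Fin 3) : IsLoweringUnitriangular eB (Qm K gρ) :=
  ⟨fun b => by simp [Qm, QZ_diag], fun b b' hne h =>
    QZ_lower gρ.1 gρ.2 b b' hne fun h0 => h (by simp [Qm, h0])⟩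

/-- `Rm` is unitriangular lowering `eC`. [cite: ConnerHarperLandsberg2023, §2.5] -/
theorem isLoweringUnitriangular_Rm (gρ : Fin 3 × Fin 3) : IsLoweringUnitriangular eC (Rm K gρ) :=
  ⟨fun c => by simp [Rm, RZ_diag], fun c c' hne h =>
    RZ_lower gρ.1 gρ.2 c c' hne fun h0 => h (by simp [Rm, h0])⟩

/-- `⟨3,3,3⟩` has integer entries. [folklore] -/
theorem intCast_matMulTensor_three (a b c : I9) :
    ((matMulTensor ℤ 3 3 3 a b c : ℤ) : K) = matMulTensor K 3 3 3 a b c := by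
  unfold matMulTensor
  split_ifs <;> simp

/-- **`⟨3,3,3⟩` is invariant under the nine root moves** (over any field).
[cite: ConnerHarperLandsberg2023, §2.4] -/
theorem invariant (gρ : Fin 3 × Fin 3) (a b c : I9) :
    ∑ a', ∑ b', ∑ c', Pm K gρ a a' * Qm K gρ b b' * Rm K gρ c c' * matMulTensor K 3 3 3 a' b' c' =
      matMulTensor K 3 3 3 a b c := by
  have h := congrArg (Int.cast : ℤ → K) (invariantZ gρ.1 gρ.2 a b c)
  simpa only [Int.cast_sum, Int.cast_mul, intCast_matMulTensor_three, Pm, Qm, Rm, Matrix.map_apply,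
    eq_intCast] using h

/-- A non-zero entry of `⟨3,3,3⟩` over `K` is a non-zero integer entry. [folklore] -/
theorem matMulTensor_int_ne_zero {a b c : I9} (h : matMulTensor K 3 3 3 a b c ≠ 0) :
    matMulTensor ℤ 3 3 3 a b c ≠ 0 := by
  intro h0
  apply h
  rw [← intCast_matMulTensor_three K, h0, Int.cast_zero]

/-- **The Borel-fixed candidate triple of `⟨3,3,3⟩`.** An order-`h` approximate decomposition of
`⟨3,3,3⟩` with `16` triads yields a candidate triple `(E₁, E₂, E₃)` (`IsCandidateTriple 16`) which is
graded for the weights `eA, eB, eC` and fixed by the nine root moves.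
[cite: ConnerHarperLandsberg2023, §2.4 and §6] -/
theorem exists_borelFixed_triple {h : ℕ} {u v w : Fin 16 → I9 → K[X]}
    (hd : IsApproxDecomposition h (matMulTensor K 3 3 3) u v w) :
    ∃ (E₁ : Submodule K (I9 × I9 → K)) (E₂ : Submodule K (I9 × I9 → K))
      (E₃ : Submodule K (I9 × I9 → K)), IsCandidateTriple 16 (matMulTensor K 3 3 3) E₁ E₂ E₃ ∧
      WtInit.IsGraded (degIK eA eB) E₁ ∧ WtInit.IsGraded (degIK eB eC) E₂ ∧
      WtInit.IsGraded (degIK eA eC) E₃ ∧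
      ∀ gρ : Fin 3 × Fin 3, E₁.map (Pm K gρ ⊗ₖ Qm K gρ).mulVecLin = E₁ ∧
        E₂.map (Qm K gρ ⊗ₖ Rm K gρ).mulVecLin = E₂ ∧ E₃.map (Pm K gρ ⊗ₖ Rm K gρ).mulVecLin = E₃ :=
  exists_borelFixed_candidateTriple hd (fun ρ => (tri ρ).1) (fun ρ => (tri ρ).2.1)
    (fun ρ => (tri ρ).2.2) tri_injective₁₂ tri_injective₂₃ tri_injective₁₃ eA eB eC eA_lt eB_lt eC_lt
    (fun c => ⟨_, fun a b hab => weight_slice₁ c a b (matMulTensor_int_ne_zero K hab)⟩)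
    (fun a => ⟨_, fun b c hbc => weight_slice₂ a b c (matMulTensor_int_ne_zero K hbc)⟩)
    (fun b => ⟨_, fun a c hac => weight_slice₃ b a c (matMulTensor_int_ne_zero K hac)⟩)
    (Pm K) (Pm' K) (Qm K) (Qm' K) (Rm K) (Rm' K) (Pm'_mul_Pm K) (Qm'_mul_Qm K) (Rm'_mul_Rm K)
    (isLoweringUnitriangular_Pm K) (isLoweringUnitriangular_Qm K) (isLoweringUnitriangular_Rm K)
    (invariant K)

end Field

end MatMul3

end BorderApolarity

end Literature.Computability.AlgebraicComplexity

end
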